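import Summits.CriticalPhenomena.PercolationContinuityZ3.Theorems.PercAnnulusCrossingIICNearCriticalLevelTwoSided
import Summits.CriticalPhenomena.PercolationContinuityZ3.Theorems.PercAnnulusCrossingIICAspectTop
import HarnessLib

/-!
# Kesten–Basu–Sapozhnikov IIC scheme in boxes, NEAR-CRITICAL series IV: the top level, two-sided, for an ABSTRACT junk weight
# (lane RSW3, p1 gen 6)

builds on p205010 (kernel theorem, internal audit signed; external expert review pending)

Seat `prim-rsw3-p1` (gen 6).  Part XIX′ (`PercAnnulusCrossingIICAspectTop.lean`) re-threaded for an ABSTRACT junk weight `J : ℕ → ℕ → ℝ`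
(hypothesis `hJ`: the level-junk inequality, see series II).  Proof = part XIX′ verbatim.  Helper file; no definitions, no sorries; every `p`, `d`.
* **`top_two_sided_junk`** — for `E` determined inside `Λ(σ M₁)`, `1 ≤ M₁ ≤ M₂`, `τ M₁ < σ M₂`, `τ M₂ < N`:
  `S_E(N) ≤ P(E ∩ {0 ↔ ∂ⁱⁿΛ(N)}) ≤ S_E(N) + ϰ⁻² J M₁ M₂ · π_p(N)`.
References: H. Kesten, PTRF 73 (1986) §2 eq. (22); D. Basu, A. Sapozhnikov, ECP 22 (2017) no. 26, §2 (2.5).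
-/

noncomputable section

namespace Summit.CriticalPhenomena.PercolationContinuityZ3.Theorems.Crossing

open MeasureTheory Literature.Probability.Percolation Literature.Probability.LatticeModels
open Literature.Probability.Percolation.DCT16
open Summit.CriticalPhenomena.PercolationContinuityZ3.Theorems.SurfaceTension
open scoped Literature.Probability.Percolation

variable {d : ℕ}

/-- **The top level, two-sided, at a general aspect, ABSTRACT junk weight `J`**: for `E` determined by `F' ⊆ Λ(σ M₁).sym2`, `1 ≤ M₁ ≤ M₂`, `τ M₁ < σ M₂`,
`τ M₂ < N`:  `S_E(N) ≤ P(E ∩ {0 ↔ ∂ⁱⁿΛ(N)}) ≤ S_E(N) + ϰ⁻² J M₁ M₂ · π_p(N)`. [cite: Kesten1986, §2 eq. (22)] [cite: BasuSapozhnikov2017ECP, §2 (2.5)] -/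
theorem top_two_sided_junk (p : unitInterval) {ϰ : ℝ} (hϰ : 0 < ϰ)
    {σ τ : ℕ → ℕ} (hσ : ∀ m : ℕ, 1 ≤ m → m < σ m) (hστ : ∀ m : ℕ, 1 ≤ m → σ m < τ m)
    (J : ℕ → ℕ → ℝ)
    (hJ : ∀ ⦃m₁ m₂ n : ℕ⦄, 1 ≤ m₁ → m₁ ≤ m₂ → τ m₁ < σ m₂ → τ m₂ < n →
      ∀ ⦃H X : Finset (Site d)⦄, H ⊆ box d (m₁ - 1) → X ⊆ box d m₁ → (∀ x ∈ X, x ∉ H) →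
      ϰ ^ 2 * (bondPercolation (zdGraph d) p).real
          ({ω : BondConfig (Site d) | ∃ x ∈ X, ∃ t ∈ innerBoundary (zdGraph d) (box d n),
              ω ∈ openConnIn ((↑(box d n) : Set (Site d)) \ ↑H) x t} ∩
           {ω : BondConfig (Site d) | ∃ t₁ ∈ innerBoundary (zdGraph d) (box d (σ m₁)), ∃ w₁ ∈ innerBoundary (zdGraph d) (box d (σ m₂)),
               ∃ t₂ ∈ innerBoundary (zdGraph d) (box d (σ m₁)), ∃ w₂ ∈ innerBoundary (zdGraph d) (box d (σ m₂)),
               ω ∩ {e : Sym2 (Site d) | e ∈ (↑((box d (σ m₂)).sym2) : Set (Sym2 (Site d))) ∧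
                   ¬ (∀ v ∈ e, v ∈ box d (σ m₁)) ∧ ¬ (∀ v ∈ e, v ∈ innerBoundary (zdGraph d) (box d (σ m₂)))} ∈
                 openConnIn (↑(box d (σ m₂)) : Set (Site d)) t₁ w₁ ∧
               ω ∩ {e : Sym2 (Site d) | e ∈ (↑((box d (σ m₂)).sym2) : Set (Sym2 (Site d))) ∧
                   ¬ (∀ v ∈ e, v ∈ box d (σ m₁)) ∧ ¬ (∀ v ∈ e, v ∈ innerBoundary (zdGraph d) (box d (σ m₂)))} ∈
                 openConnIn (↑(box d (σ m₂)) : Set (Site d)) t₂ w₂ ∧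
               ω ∩ {e : Sym2 (Site d) | e ∈ (↑((box d (σ m₂)).sym2) : Set (Sym2 (Site d))) ∧
                   ¬ (∀ v ∈ e, v ∈ box d (σ m₁)) ∧ ¬ (∀ v ∈ e, v ∈ innerBoundary (zdGraph d) (box d (σ m₂)))} ∉
                 openConnIn (↑(box d (σ m₂)) : Set (Site d)) w₁ w₂}) ≤
        J m₁ m₂ * (bondPercolation (zdGraph d) p).real {ω : BondConfig (Site d) | ∃ x ∈ X, ∃ t ∈ innerBoundary (zdGraph d) (box d n),
            ω ∈ openConnIn ((↑(box d n) : Set (Site d)) \ ↑H) x t})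
    {M₁ M₂ N : ℕ} (hM₁ : 1 ≤ M₁) (hM₁₂ : M₁ ≤ M₂) (h12 : τ M₁ < σ M₂) (hN : τ M₂ < N)
    {E : Set (BondConfig (Site d))} {F' : Finset (Sym2 (Site d))} (hE : DeterminedBy E ↑F') (hF' : F' ⊆ (box d (σ M₁)).sym2) :
    ∑ C ∈ ((box d (σ M₂)).powerset.filter (fun U => box d (σ M₁) ⊆ U)) ×ˢ (box d (σ M₂ + 1)).powerset,
        (bondPercolation (zdGraph d) p).real (E ∩
          {ω : BondConfig (Site d) | ω ∩ (↑((box d (σ M₂ + 1)).sym2) : Set (Sym2 (Site d))) ∈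
            explEvent (↑(box d (σ M₁)) : Set (Site d)) ((↑(box d (σ M₂)) : Set (Site d)) \ ↑(box d (σ M₁))) ↑C.1 ↑C.2} ∩
          {ω : BondConfig (Site d) | ∀ r ∈ C.2, ∀ r' ∈ C.2, ∃ v ∈ C.1, ∃ v' ∈ C.1,
            s(v, r) ∈ ω ∧ s(v', r') ∈ ω ∧ ω ∈ openConnIn ((↑C.1 : Set (Site d)) \ ↑(box d (σ M₁ - 1))) v v'} ∩
          {ω : BondConfig (Site d) | ∃ x ∈ ({0} : Finset (Site d)), ∃ r ∈ C.2, ∃ v ∈ C.1, ω ∈ openConnIn ((↑C.1 : Set (Site d)) \ ↑(∅ : Finset (Site d))) x v ∧ s(v, r) ∈ ω}) *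
        (bondPercolation (zdGraph d) p).real {ω : BondConfig (Site d) | ∃ x ∈ C.2, ∃ t ∈ innerBoundary (zdGraph d) (box d N),
            ω ∈ openConnIn ((↑(box d N) : Set (Site d)) \ ↑C.1) x t} ≤
      (bondPercolation (zdGraph d) p).real (E ∩ siteToBoundary d N) ∧
    (bondPercolation (zdGraph d) p).real (E ∩ siteToBoundary d N) ≤
      ∑ C ∈ ((box d (σ M₂)).powerset.filter (fun U => box d (σ M₁) ⊆ U)) ×ˢ (box d (σ M₂ + 1)).powerset,
        (bondPercolation (zdGraph d) p).real (E ∩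
          {ω : BondConfig (Site d) | ω ∩ (↑((box d (σ M₂ + 1)).sym2) : Set (Sym2 (Site d))) ∈
            explEvent (↑(box d (σ M₁)) : Set (Site d)) ((↑(box d (σ M₂)) : Set (Site d)) \ ↑(box d (σ M₁))) ↑C.1 ↑C.2} ∩
          {ω : BondConfig (Site d) | ∀ r ∈ C.2, ∀ r' ∈ C.2, ∃ v ∈ C.1, ∃ v' ∈ C.1,
            s(v, r) ∈ ω ∧ s(v', r') ∈ ω ∧ ω ∈ openConnIn ((↑C.1 : Set (Site d)) \ ↑(box d (σ M₁ - 1))) v v'} ∩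
          {ω : BondConfig (Site d) | ∃ x ∈ ({0} : Finset (Site d)), ∃ r ∈ C.2, ∃ v ∈ C.1, ω ∈ openConnIn ((↑C.1 : Set (Site d)) \ ↑(∅ : Finset (Site d))) x v ∧ s(v, r) ∈ ω}) *
        (bondPercolation (zdGraph d) p).real {ω : BondConfig (Site d) | ∃ x ∈ C.2, ∃ t ∈ innerBoundary (zdGraph d) (box d N),
            ω ∈ openConnIn ((↑(box d N) : Set (Site d)) \ ↑C.1) x t} +
      ϰ⁻¹ ^ 2 * J M₁ M₂ * oneArmProb d p N := by
  classical
  have hX : ({0} : Finset (Site d)) ⊆ box d M₁ := Finset.singleton_subset_iff.2 (zero_mem_box d M₁)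
  have h := sum_real_level_two_sided_junk p hϰ hσ hστ J hJ hM₁ hM₁₂ h12 hN (H := (∅ : Finset (Site d)))
    (X := ({0} : Finset (Site d)))
    (Finset.empty_subset _) hX (fun x _ => Finset.notMem_empty x) hE hF'
  rw [conn_empty_zero_eq] at h
  refine ⟨h.2, ?_⟩
  have : oneArmProb d p N = (bondPercolation (zdGraph d) p).real (siteToBoundary d N) := rfl
  rw [this]
  linarith [h.1]

end Summit.CriticalPhenomena.PercolationContinuityZ3.Theorems.Crossing

end
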